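import Summits.QuantumFields.YangMills.Theorems.UnitScaleTiltProp7QTwSEllTwoBound
import Summits.QuantumFields.YangMills.Theorems.UnitScaleTiltProp7QkLocalGaugeComparison
import Summits.QuantumFields.YangMills.Theorems.UnitScaleTiltProp7CmapTwSReadSet
import Summits.QuantumFields.YangMills.Theorems.UnitScaleTiltProp7LODCutoffBlockSplit
import HarnessLib

/-!
# Route `UnitScaleTilt`, crux «MinimiserStabilityRegPr» (stmt-QuantumFields-19200, stub EX), γ-row `hGF[Lift]` (LOD line) — ★★★ THE SLOT `hK₃` OF w5 g13's (L6) KNIT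
# ✓`Prop7LODAssembly.curvedTarget_of_LOD_topMean`: THE CUTOFF COMMUTATOR OF PRINT'S AVERAGING OPERATOR `Q_k(U₀)` AT A PRINTED-REGULAR BACKGROUND,
# `Σ_c ‖Q_k(U₀)(M_c A) − N₃ᶜ(Q_k(U₀)A)‖² ≤ 4320·(ℓ²B)·(cB∕(c₀ℓ^d))·‖A‖²` for cut-offs `χ_c` with `Σ_c (χ_c(x+e_μ) − χ_c(x))² ≤ B` (so `μ₃ = 0`, `κ₃² = 4320·a·ℓ²B·cB∕(c₀ℓ^d)`)

Cell `ym3-torus` (rung R3 — YM₃ on T³; NOT d = 4, NOT the Clay problem).  Width seat `ym-routeR-w4` g26 (chair ★p1 g24 BOOK 2026-08-30 00:45:36Z «`hK₃` ← routeR-w4 g26»; px17 g8 00:53:42Z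
«hK₃ is YOURS» + the operator READINGS of ✓∕⧗`Prop7LODCutoffDock.exists_LOD_cutoffs_corner`).  THEOREMS ONLY (0 `def`, 0 `sorry`); `--supports stmt-QuantumFields-19200 --as helper`;
count-neutral.  FILE 2 of the pen (FILES 1a∕1b = ✓`Prop7QTwSEllTwoPlainTube` ∕ ✓`Prop7QTwSEllTwoBound`: `Σ‖QTwS U₀ Y‖_HS² ≤ 36(ℓ²∕ℓ^d)Σ‖Y‖_HS²`).

THE MATHEMATICS.  Cut-offs `χ_c : sites → ℝ` (index `c` in a finite set `s`; at the member px17's `Zc`, `χ c x`), bond multiplier `(M_c A)(b) = χ_c(b₋)·A(b)` (px17's `srcMul` reading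
`hM`), block multiplier `(N₃ᶜ z)(c') = χ_c(x₀(ĉ))·z(c')` with `x₀(ĉ)` = the corner `Site.fibreSite 0 (K−n) ĉ₋ 0` of the source block of `ĉ = bondShift (sites_eq F n K h) c'` (reading `hN`,
px17's `exists_LOD_cutoffs_corner`).  Per `(c, c')`:
  `QTwS U₀ (χ_c•X) c' − χ_c(x₀(ĉ))•QTwS U₀ X c' = QTwS U₀ ((χ_c − χ_c(x₀(ĉ)))•X) c' = QTwS U₀ (1_{R(ĉ)}·(χ_c − χ_c(x₀(ĉ)))•X) c'`
by ℂ-linearity and TWO-BLOCK LOCALITY ✓`Prop7CmapTwSReadSet.QTwS_congr_of_agree` (`R(ĉ)` = fine bonds whose source block is `ĉ₋` or `ĉ₊`).  On `R(ĉ)`,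
`χ_c(b₋) − χ_c(x₀(ĉ)) = δ_c(b₋)` (source block `ĉ₋`) or `δ_c(b₋) + (g_c(ĉ₊) − g_c(ĉ₋))` (source block `ĉ₊`), `δ_c(x) = χ_c(x) − χ_c(corner(B x))`, `g_c(Y) = χ_c(corner Y)`; px17's rows
✓`Prop7LODCutoffBlockSplit.sum_sq_sub_corner_le` (`Σ_cδ_c(x)² ≤ (d(ℓ−1))²B`) and ✓`sum_sq_corner_shift_sub_le` (`Σ_c(g_c(Y+e_μ) − g_c(Y))² ≤ ℓ²B`) give
`Σ_c (χ_c(b₋) − χ_c(x₀(ĉ)))² ≤ 2((d(ℓ−1))² + ℓ²)B ≤ 20ℓ²B` (§1).  Bounding the `c'`-th entry by the full `ℓ²` norm (FILE 1b, constant `36`), summing `Σ_{c∈s}` under the integral and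
using the READ-SET MULTIPLICITY `#{c' : b ∈ R(ĉ')} ≤ 2d = 6` (§1: `Σ_{c'}Σ_{b∈R(ĉ')} g(b) ≤ 2d·Σ_b g(b)`):
  ★★ `Σ_{c∈s} Σ_{c'} ‖QTwS U₀ (χ_c•X) c' − χ_c(x₀(ĉ))•QTwS U₀ X c'‖_HS² ≤ 36·6·20·ℓ²B·(ℓ²∕ℓ^d)·Σ_b ‖X b‖_HS² = 4320·ℓ²B·(ℓ²∕ℓ^d)·Σ_b ‖X b‖_HS²` (§2),
and in the target's letters (`Q_k = η•toL2B∘QTwS∘toL2⁻¹`, `η²ℓ² = 1`, ✓`Prop7QkLocalGaugeComparison.normSq_eta_smul_toL2B`, ✓`norm_sq_toL2`):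
  ★★★ `Σ_{c∈s} ‖Qk U₀ (M_c A) − N₃ᶜ (Qk U₀ A)‖² ≤ 4320·ℓ²B·(cB∕(c₀ℓ^d))·‖A‖²` for ANY linear `M_c`, `N₃ᶜ` with the two readings (§3) — w5's `hK₃` with `μ₃ = 0` after `a·`.
At px17's family (`B = 2880∕(L^sℓ)²`, pins `cB = c₀ℓ³`): `κ₃² = 4320·2880·a∕L^{2s}` — K-free, |T³|-free, small for the IMS scale `R′ = L^s` large.
HONEST SCOPE.  Bookkeeping over landed rows (two-block locality, px17's cut-off rows, FILE 1b); NO exact commutation `[Q_k(U₀), χ̄] = 0` is claimed (the averaging contour crosses block faces —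
the coarse increment `g_c(ĉ₊) − g_c(ĉ₋)` is paid for, not dropped); the knit's other slots, `hT`, `hGF`, the print rows, `hThm2S`, EX and the crux are NOT proved here.
References: T. Bałaban, CMP **99** (1985) 389–434 [Balaban1985BackgroundPropagators] ((3.13)–(3.16) p.393, (3.100) pp.413–414); CMP **95** (1984) 17–40 [Balaban1984PropagatorsI]
((1.6) p.18, (1.18)–(1.20) pp.19–20); CMP **98** (1985) 17–51 [Balaban1985Averaging] ((18)–(20) p.21, (110) p.34, Prop. 3 p.36); CMP **102** (1985) 277–309 [Balaban1985Variational]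
((44)–(45) p.285, (72) p.289); B. Simon, Ann. IHP A **38** (1983) 295–308 (IMS localisation).
-/

set_option autoImplicit false

noncomputable section

open scoped BigOperators Matrix.Norms.L2Operator Matrix

namespace Summit.QuantumFields.YangMills.Theorems.Prop7QkCutoffCommutator

open Literature.MathematicalPhysics.QuantumFieldTheory.Balaban1983to89
open Literature.MathematicalPhysics.QuantumFieldTheory.Balaban1983to89.T3ContinuumYM3Torus
open Finset T4Continuum BlockAveraging LatticeFieldCalculus
open B5Eq118OneStroke (iterBlockOf)
open B10StarCount (sum_pbond)
open B11Eq103H1Complex (BondL2K)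
open B9Eq311L2Pairing (WL2)
open T3LevelShift (bondShift)
open T3PrintedRegularOrbits (sites_eq)
open T3PrintedRegularMinimiser (RegPr)
open T3SectALandauChart (eta eta_pos)
open Summit.QuantumFields.YangMills.Theorems.Prop7SectET3Transport (periodsT3)
open Summit.QuantumFields.YangMills.Theorems.Prop7SymAvgTwSym (QTwS)
open Summit.QuantumFields.YangMills.Theorems.Prop7SectET3HilbertLetters (W₂ toL2 toL2B)
open Summit.QuantumFields.YangMills.Theorems.Prop7SectET3CurvedPropagators (Qk)
open Summit.QuantumFields.YangMills.Theorems.Prop7LaplaceAFlatLetters (norm_sq_toL2)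
open Summit.QuantumFields.YangMills.Theorems.Prop7TransverseRowOfTubeRowRegPr (Qk_toL2)
open Summit.QuantumFields.YangMills.Theorems.Prop7QkLocalGaugeComparison (normSq_eta_smul_toL2B)
open Summit.QuantumFields.YangMills.Theorems.Prop7CmapTwSReadSet (QTwS_congr_of_agree)
open Summit.QuantumFields.YangMills.Theorems.Prop7LODCutoffBlockSplit (sum_sq_sub_corner_le sum_sq_corner_shift_sub_le)
open Summit.QuantumFields.YangMills.Theorems.Prop7QTwSEllTwoBound (sum_normSq_entries_QTwS_le)

variable (F : T3Family) (n K : ℕ)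

/-! ## §1 Read-set geometry: the oscillation of the cut-offs on the read set of a coarse bond, and the read-set multiplicity -/

section Geometry

variable (h : n ≤ K)

/-- ★ **OSCILLATION ON THE READ SET**: for a coarse bond `ĉ` (level `K − n`) and a fine bond `b` whose source block is `ĉ₋` or `ĉ₊`, a family of cut-offs with the Lipschitz-sum row
`Σ_{c∈s} (χ_c(x+e_μ) − χ_c(x))² ≤ B` satisfies `Σ_{c∈s} (χ_c(b₋) − χ_c(x₀(ĉ)))² ≤ 2·((d(ℓ−1))² + ℓ²)·B` (`x₀(ĉ)` = corner of the block `ĉ₋`; px17's in-block row on `ĉ₋`, in-block + ONE coarse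
step on `ĉ₊`). [cite: Balaban1984PropagatorsI, (1.6) p.18, (1.18) p.20; Balaban1985BackgroundPropagators, (3.100) pp.413-414] -/
theorem sum_sq_sub_corner_le_of_read {ι : Type*} (s : Finset ι) (χ : ι → Site (F.P K) 0 → ℝ) {B : ℝ} (hB : 0 ≤ B)
    (hfam : ∀ (x : Site (F.P K) 0) (μ : Fin (F.P K).d), ∑ c ∈ s, (χ c (x.shift μ) - χ c x) ^ 2 ≤ B)
    (c' : PBond (F.P K) (K - n)) (b : PBond (F.P K) 0) (hb : (iterBlockOf (K - n) b.src = (c').src ∨ iterBlockOf (K - n) b.src = (c').tgt)) :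
    ∑ c ∈ s, (χ c b.src - χ c (Site.fibreSite 0 (K - n) (c').src fun _ => (⟨0, pow_pos (F.P K).L_pos (K - n)⟩ : Fin ((F.P K).L ^ (K - n))))) ^ 2
      ≤ 2 * ((((F.P K).d : ℝ) * (((F.L : ℝ) ^ (K - n)) - 1)) ^ 2 + ((F.L : ℝ) ^ (K - n)) ^ 2) * B := by
  have hk : K - n ≤ (F.P K).m + (F.P K).K := by show K - n ≤ F.m + K; omega
  have hLL : ((F.P K).L : ℝ) = F.L := rfl
  have hin := sum_sq_sub_corner_le (k := K - n) hk s χ hB hfam b.src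
  rw [hLL] at hin
  have hP1 : 0 ≤ (((F.P K).d : ℝ) * (((F.L : ℝ) ^ (K - n)) - 1)) ^ 2 * B := by positivity
  have hP2 : 0 ≤ ((F.L : ℝ) ^ (K - n)) ^ 2 * B := by positivity
  rcases hb with hbs | hbt
  · -- source block `ĉ₋`: the in-block oscillation alone
    rw [← hbs]
    linarith
  · -- source block `ĉ₊ = ĉ₋ + e_{μ(ĉ)}`: in-block oscillation + one coarse step
    have hco := sum_sq_corner_shift_sub_le (k := K - n) hk s χ hB hfam c'.src c'.dir
    rw [hLL] at hco
    have htgt : c'.tgt = c'.src.shift c'.dir := rfl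
    rw [htgt] at hbt
    -- `(u + v)² ≤ 2u² + 2v²` termwise
    have hsplit : ∑ c ∈ s, (χ c b.src - χ c (Site.fibreSite 0 (K - n) (c').src fun _ => (⟨0, pow_pos (F.P K).L_pos (K - n)⟩ : Fin ((F.P K).L ^ (K - n))))) ^ 2
        ≤ 2 * ∑ c ∈ s, (χ c b.src - χ c (Site.fibreSite 0 (K - n) (iterBlockOf (K - n) b.src) fun _ => (⟨0, pow_pos (F.P K).L_pos (K - n)⟩ : Fin ((F.P K).L ^ (K - n))))) ^ 2
          + 2 * ∑ c ∈ s, (χ c (Site.fibreSite 0 (K - n) (c'.src.shift c'.dir) fun _ => (⟨0, pow_pos (F.P K).L_pos (K - n)⟩ : Fin ((F.P K).L ^ (K - n))))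
              - χ c (Site.fibreSite 0 (K - n) (c').src fun _ => (⟨0, pow_pos (F.P K).L_pos (K - n)⟩ : Fin ((F.P K).L ^ (K - n))))) ^ 2 := by
      rw [Finset.mul_sum, Finset.mul_sum, ← Finset.sum_add_distrib]
      refine Finset.sum_le_sum fun c _ => ?_
      rw [hbt]
      nlinarith [sq_nonneg (χ c b.src - χ c (Site.fibreSite 0 (K - n) (c'.src.shift c'.dir) fun _ => (⟨0, pow_pos (F.P K).L_pos (K - n)⟩ : Fin ((F.P K).L ^ (K - n))))
        - (χ c (Site.fibreSite 0 (K - n) (c'.src.shift c'.dir) fun _ => (⟨0, pow_pos (F.P K).L_pos (K - n)⟩ : Fin ((F.P K).L ^ (K - n)))) - χ c (Site.fibreSite 0 (K - n) (c').src fun _ => (⟨0, pow_pos (F.P K).L_pos (K - n)⟩ : Fin ((F.P K).L ^ (K - n))))))]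
    linarith

/-- ★ **READ-SET MULTIPLICITY**: each fine bond lies in the read sets of at most `2d` coarse bonds (its source block is the source of `d` coarse bonds and the target of `d`):
`Σ_{c'} Σ_b 1_{R(ĉ')}(b)·g(b) ≤ 2d·Σ_b g(b)` for `g ≥ 0`. [cite: Balaban1984PropagatorsI, (1.18) p.20] -/
theorem sum_sum_read_le (g : PBond (F.P K) 0 → ℝ) (hg : ∀ b, 0 ≤ g b) :
    ∑ c' : PBond (F.P K) (K - n), ∑ b : PBond (F.P K) 0, (if (iterBlockOf (K - n) b.src = (c').src ∨ iterBlockOf (K - n) b.src = (c').tgt) then g b else 0)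
      ≤ 2 * ((F.P K).d : ℝ) * ∑ b : PBond (F.P K) 0, g b := by
  classical
  -- split the indicator
  have hsplit : ∀ (c' : PBond (F.P K) (K - n)) (b : PBond (F.P K) 0), (if (iterBlockOf (K - n) b.src = (c').src ∨ iterBlockOf (K - n) b.src = (c').tgt) then g b else 0)
      ≤ (if iterBlockOf (K - n) b.src = c'.src then g b else 0) + (if iterBlockOf (K - n) b.src = c'.tgt then g b else 0) := by
    intro c' b
    have hgb := hg b
    by_cases h1 : iterBlockOf (K - n) b.src = c'.src
    · by_cases h2 : iterBlockOf (K - n) b.src = c'.tgt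
      · rw [if_pos (Or.inl h1), if_pos h1, if_pos h2]; linarith
      · rw [if_pos (Or.inl h1), if_pos h1, if_neg h2, add_zero]
    · by_cases h2 : iterBlockOf (K - n) b.src = c'.tgt
      · rw [if_pos (Or.inr h2), if_neg h1, if_pos h2, zero_add]
      · rw [if_neg (not_or.mpr ⟨h1, h2⟩), if_neg h1, if_neg h2, add_zero]
  -- the source count: `Σ_{c'} 1[B(b₋) = ĉ'₋] = d`
  have hsrc : ∑ c' : PBond (F.P K) (K - n), ∑ b : PBond (F.P K) 0, (if iterBlockOf (K - n) b.src = c'.src then g b else 0)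
      = ((F.P K).d : ℝ) * ∑ b : PBond (F.P K) 0, g b := by
    rw [Finset.sum_comm, Finset.mul_sum]
    refine Finset.sum_congr rfl fun b _ => ?_
    rw [sum_pbond]
    change ∑ x : Site (F.P K) (K - n), ∑ μ : Fin (F.P K).d, (if iterBlockOf (K - n) b.src = x then g b else 0) = _
    rw [Finset.sum_comm]
    have hμ : ∀ μ : Fin (F.P K).d, ∑ x : Site (F.P K) (K - n), (if iterBlockOf (K - n) b.src = x then g b else 0) = g b := by
      intro μ
      rw [Finset.sum_ite_eq, if_pos (Finset.mem_univ _)]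
    rw [Finset.sum_congr rfl fun μ _ => hμ μ, Finset.sum_const, Finset.card_univ, Fintype.card_fin, nsmul_eq_mul]
  -- the target count: `Σ_{c'} 1[B(b₋) = ĉ'₊] = d` (translation by `e_μ` is a bijection of the coarse sites)
  have htgt : ∑ c' : PBond (F.P K) (K - n), ∑ b : PBond (F.P K) 0, (if iterBlockOf (K - n) b.src = c'.tgt then g b else 0)
      = ((F.P K).d : ℝ) * ∑ b : PBond (F.P K) 0, g b := by
    rw [Finset.sum_comm, Finset.mul_sum]
    refine Finset.sum_congr rfl fun b _ => ?_
    rw [sum_pbond]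
    change ∑ x : Site (F.P K) (K - n), ∑ μ : Fin (F.P K).d, (if iterBlockOf (K - n) b.src = x.shift μ then g b else 0) = _
    rw [Finset.sum_comm]
    have hμ : ∀ μ : Fin (F.P K).d, ∑ x : Site (F.P K) (K - n), (if iterBlockOf (K - n) b.src = x.shift μ then g b else 0) = g b := by
      intro μ
      have hre : ∑ x : Site (F.P K) (K - n), (if iterBlockOf (K - n) b.src = x.shift μ then g b else 0)
          = ∑ x : Site (F.P K) (K - n), (if iterBlockOf (K - n) b.src = x then g b else 0) :=
        Equiv.sum_comp (shiftEquiv (P := F.P K) (j := K - n) μ) (fun x => if iterBlockOf (K - n) b.src = x then g b else 0)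
      rw [hre, Finset.sum_ite_eq, if_pos (Finset.mem_univ _)]
    rw [Finset.sum_congr rfl fun μ _ => hμ μ, Finset.sum_const, Finset.card_univ, Fintype.card_fin, nsmul_eq_mul]
  calc ∑ c' : PBond (F.P K) (K - n), ∑ b : PBond (F.P K) 0, (if (iterBlockOf (K - n) b.src = (c').src ∨ iterBlockOf (K - n) b.src = (c').tgt) then g b else 0)
      ≤ ∑ c' : PBond (F.P K) (K - n), ∑ b : PBond (F.P K) 0, ((if iterBlockOf (K - n) b.src = c'.src then g b else 0) + (if iterBlockOf (K - n) b.src = c'.tgt then g b else 0)) :=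
        Finset.sum_le_sum fun c' _ => Finset.sum_le_sum fun b _ => hsplit c' b
    _ = ((F.P K).d : ℝ) * ∑ b : PBond (F.P K) 0, g b + ((F.P K).d : ℝ) * ∑ b : PBond (F.P K) 0, g b := by
        simp only [Finset.sum_add_distrib]; rw [hsrc, htgt]
    _ = 2 * ((F.P K).d : ℝ) * ∑ b : PBond (F.P K) 0, g b := by ring

end Geometry

/-! ## §2 ★★ The cutoff commutator of `QTwS U₀` in carrier letters (Hilbert–Schmidt currency) -/

section Carrier

variable (h : n ≤ K)

set_option maxHeartbeats 400000 in
/-- ★★ **THE CUTOFF COMMUTATOR OF THE AVERAGING OPERATOR OF RECORD, CARRIER LETTERS.**  `RegPr F n K ε₀ U₀`, `10¹⁰L⁶ε₀ ≤ 1`, `10¹²L³ε₀ ≤ 1`; cut-offs `χ : ι → sites → ℝ` with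
`Σ_{c∈s} (χ_c(x+e_μ) − χ_c(x))² ≤ B` for all `x, μ`; `X : bonds → M₂(ℂ)` arbitrary.  Then
`Σ_{c∈s} Σ_{c'} Σ_{jk} |(QTwS U₀ (χ_c(·₋)•X) c' − χ_c(x₀(ĉ))•QTwS U₀ X c')_{jk}|² ≤ 4320·(ℓ²·B)·(ℓ²∕ℓ^d)·Σ_b Σ_{jk} |X(b)_{jk}|²` (`d = 3`; `4320 = 36·6·20`).
PROOF: ℂ-linearity; two-block locality ✓`QTwS_congr_of_agree` truncates `(χ_c − χ_c(x₀(ĉ)))•X` to the read set of `ĉ`; FILE 1b ✓`sum_normSq_entries_QTwS_le` on the truncated field;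
§1 under the sum. [cite: Balaban1985BackgroundPropagators, (3.13)-(3.16) p.393, (3.100) pp.413-414; Balaban1985Averaging, (110) p.34; Balaban1984PropagatorsI, (1.18) p.20] -/
theorem sum_normSq_entries_QTwS_cutoff_comm_le {ε₀ : ℝ} (hε₀ : 0 < ε₀) (hε : 10 ^ 10 * (F.L : ℝ) ^ 6 * ε₀ ≤ 1) (hε12 : 10 ^ 12 * (F.L : ℝ) ^ 3 * ε₀ ≤ 1)
    (W : GaugeField (F.P K) 0 (Matrix.specialUnitaryGroup (Fin 2) ℂ)) (hreg : RegPr F n K ε₀ W)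
    {ι : Type*} (s : Finset ι) (χ : ι → Site (F.P K) 0 → ℝ) {B : ℝ} (hB : 0 ≤ B)
    (hfam : ∀ (x : Site (F.P K) 0) (μ : Fin (F.P K).d), ∑ c ∈ s, (χ c (x.shift μ) - χ c x) ^ 2 ≤ B)
    (X : PBond (F.P K) 0 → Matrix (Fin 2) (Fin 2) ℂ) :
    ∑ c ∈ s, ∑ bc : PBond (F.P n) 0, ∑ j, ∑ k,
        ‖(QTwS F n K h W (fun b => χ c b.src • X b) bc - χ c (Site.fibreSite 0 (K - n) (bondShift (sites_eq F n K h) bc).src fun _ => (⟨0, pow_pos (F.P K).L_pos (K - n)⟩ : Fin ((F.P K).L ^ (K - n)))) • QTwS F n K h W X bc) j k‖ ^ 2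
      ≤ 4320 * (((F.L : ℝ) ^ (K - n)) ^ 2 * B) * (((F.L : ℝ) ^ (K - n)) ^ 2 / ((F.L : ℝ) ^ (K - n)) ^ (F.P K).d) * ∑ b : PBond (F.P K) 0, ∑ j, ∑ k, ‖X b j k‖ ^ 2 := by
  classical
  have hd : (F.P K).d = 3 := T3Family.P_d F K
  have hL3 : (3 : ℝ) ≤ F.L := by
    have h3 : 3 ≤ F.L := by obtain ⟨a, ha⟩ := F.hL.1; have := F.hL.2; omega
    exact_mod_cast h3
  have hL0 : (0 : ℝ) < F.L := by linarith
  have hℓ1 : (1 : ℝ) ≤ ((F.L : ℝ) ^ (K - n)) := one_le_pow₀ (by linarith)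
  -- a window letter for the locality lemma
  set e : ℝ := (10 ^ 9 * (F.L : ℝ) ^ 2)⁻¹ with he_def
  have he : 0 < e := by rw [he_def]; positivity
  have hWe : 10 ^ 9 * (F.L : ℝ) ^ 2 * e ≤ 1 := by rw [he_def, mul_inv_cancel₀ (by positivity)]
  set ρ : ℝ := ((F.L : ℝ) ^ (K - n)) ^ 2 / ((F.L : ℝ) ^ (K - n)) ^ (F.P K).d with hρ
  have hρ0 : 0 ≤ ρ := by positivity
  set E : ℝ := 2 * ((((F.P K).d : ℝ) * (((F.L : ℝ) ^ (K - n)) - 1)) ^ 2 + ((F.L : ℝ) ^ (K - n)) ^ 2) * B with hE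
  have hE0 : 0 ≤ E := by positivity
  -- the truncated oscillation field of `(c, bc)`
  set φ : ι → PBond (F.P n) 0 → PBond (F.P K) 0 → ℝ := fun c bc b =>
    if (iterBlockOf (K - n) b.src = (bondShift (sites_eq F n K h) bc).src ∨ iterBlockOf (K - n) b.src = (bondShift (sites_eq F n K h) bc).tgt) then χ c b.src - χ c (Site.fibreSite 0 (K - n) (bondShift (sites_eq F n K h) bc).src fun _ => (⟨0, pow_pos (F.P K).L_pos (K - n)⟩ : Fin ((F.P K).L ^ (K - n)))) else 0 with hφ
  -- per `(c, bc)`: linearity + locality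
  have hloc : ∀ (c : ι) (bc : PBond (F.P n) 0),
      QTwS F n K h W (fun b => χ c b.src • X b) bc - χ c (Site.fibreSite 0 (K - n) (bondShift (sites_eq F n K h) bc).src fun _ => (⟨0, pow_pos (F.P K).L_pos (K - n)⟩ : Fin ((F.P K).L ^ (K - n)))) • QTwS F n K h W X bc
        = QTwS F n K h W (fun b => ((φ c bc b : ℝ) : ℂ) • X b) bc := by
    intro c bc
    -- real scalars as complex scalars
    have h1 : (fun b => χ c b.src • X b) = fun b => ((χ c b.src : ℝ) : ℂ) • X b := by
      funext b; ext i j; simp [Matrix.smul_apply, Complex.real_smul]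
    have h2 : χ c (Site.fibreSite 0 (K - n) (bondShift (sites_eq F n K h) bc).src fun _ => (⟨0, pow_pos (F.P K).L_pos (K - n)⟩ : Fin ((F.P K).L ^ (K - n)))) • QTwS F n K h W X bc = (QTwS F n K h W (fun b => ((χ c (Site.fibreSite 0 (K - n) (bondShift (sites_eq F n K h) bc).src fun _ => (⟨0, pow_pos (F.P K).L_pos (K - n)⟩ : Fin ((F.P K).L ^ (K - n)))) : ℝ) : ℂ) • X b)) bc := by
      have : (fun b => ((χ c (Site.fibreSite 0 (K - n) (bondShift (sites_eq F n K h) bc).src fun _ => (⟨0, pow_pos (F.P K).L_pos (K - n)⟩ : Fin ((F.P K).L ^ (K - n)))) : ℝ) : ℂ) • X b) = ((χ c (Site.fibreSite 0 (K - n) (bondShift (sites_eq F n K h) bc).src fun _ => (⟨0, pow_pos (F.P K).L_pos (K - n)⟩ : Fin ((F.P K).L ^ (K - n)))) : ℝ) : ℂ) • X := rfl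
      rw [this, map_smul, Pi.smul_apply]
      ext i j; simp [Matrix.smul_apply, Complex.real_smul]
    rw [h1, h2, ← Pi.sub_apply, ← map_sub]
    refine QTwS_congr_of_agree F n K h hε₀ he hWe hε12 W hreg bc fun b hbs _ => ?_
    simp only [Pi.sub_apply, hφ, if_pos hbs]
    push_cast
    rw [sub_smul]
  -- per `(c, bc)`: the entry is bounded by the full `ℓ²` norm of `QTwS` on the truncated field (FILE 1b)
  have hper : ∀ (c : ι) (bc : PBond (F.P n) 0),
      ∑ j, ∑ k, ‖(QTwS F n K h W (fun b => χ c b.src • X b) bc - χ c (Site.fibreSite 0 (K - n) (bondShift (sites_eq F n K h) bc).src fun _ => (⟨0, pow_pos (F.P K).L_pos (K - n)⟩ : Fin ((F.P K).L ^ (K - n)))) • QTwS F n K h W X bc) j k‖ ^ 2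
        ≤ 36 * ρ * ∑ b : PBond (F.P K) 0, (φ c bc b) ^ 2 * ∑ j, ∑ k, ‖X b j k‖ ^ 2 := by
    intro c bc
    rw [hloc c bc]
    have hfull := sum_normSq_entries_QTwS_le F n K h hε₀ hε hε12 W hreg (fun b => ((φ c bc b : ℝ) : ℂ) • X b)
    rw [← hρ] at hfull
    have hone : ∑ j, ∑ k, ‖(QTwS F n K h W (fun b => ((φ c bc b : ℝ) : ℂ) • X b) bc) j k‖ ^ 2
        ≤ ∑ bc' : PBond (F.P n) 0, ∑ j, ∑ k, ‖(QTwS F n K h W (fun b => ((φ c bc b : ℝ) : ℂ) • X b) bc') j k‖ ^ 2 :=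
      Finset.single_le_sum (f := fun bc' => ∑ j, ∑ k, ‖(QTwS F n K h W (fun b => ((φ c bc b : ℝ) : ℂ) • X b) bc') j k‖ ^ 2)
        (fun bc' _ => by positivity) (Finset.mem_univ bc)
    have hsm : ∀ b : PBond (F.P K) 0, ∑ j, ∑ k, ‖((((φ c bc b : ℝ) : ℂ) • X b) : Matrix (Fin 2) (Fin 2) ℂ) j k‖ ^ 2 = (φ c bc b) ^ 2 * ∑ j, ∑ k, ‖X b j k‖ ^ 2 := by
      intro b
      rw [Finset.mul_sum]; refine Finset.sum_congr rfl fun j _ => ?_; rw [Finset.mul_sum]; refine Finset.sum_congr rfl fun k _ => ?_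
      rw [Matrix.smul_apply, smul_eq_mul, norm_mul, Complex.norm_real, Real.norm_eq_abs, mul_pow, sq_abs]
    simp only [hsm] at hfull
    exact hone.trans hfull
  -- §1 under the sum: `Σ_{c∈s} φ_c(bc, b)² ≤ 1_R(b)·E`
  have hφs : ∀ (bc : PBond (F.P n) 0) (b : PBond (F.P K) 0), ∑ c ∈ s, (φ c bc b) ^ 2
      ≤ if (iterBlockOf (K - n) b.src = (bondShift (sites_eq F n K h) bc).src ∨ iterBlockOf (K - n) b.src = (bondShift (sites_eq F n K h) bc).tgt) then E else 0 := by
    intro bc b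
    by_cases hb : (iterBlockOf (K - n) b.src = (bondShift (sites_eq F n K h) bc).src ∨ iterBlockOf (K - n) b.src = (bondShift (sites_eq F n K h) bc).tgt)
    · simp only [hφ, if_pos hb]
      rw [hE]
      exact sum_sq_sub_corner_le_of_read F n K s χ hB hfam (bondShift (sites_eq F n K h) bc) b hb
    · simp only [hφ, if_neg hb]
      simp
  -- assemble
  have hN : ∀ b : PBond (F.P K) 0, 0 ≤ ∑ j, ∑ k, ‖X b j k‖ ^ 2 := fun b => by positivity
  calc ∑ c ∈ s, ∑ bc : PBond (F.P n) 0, ∑ j, ∑ k,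
        ‖(QTwS F n K h W (fun b => χ c b.src • X b) bc - χ c (Site.fibreSite 0 (K - n) (bondShift (sites_eq F n K h) bc).src fun _ => (⟨0, pow_pos (F.P K).L_pos (K - n)⟩ : Fin ((F.P K).L ^ (K - n)))) • QTwS F n K h W X bc) j k‖ ^ 2
      ≤ ∑ c ∈ s, ∑ bc : PBond (F.P n) 0, 36 * ρ * ∑ b : PBond (F.P K) 0, (φ c bc b) ^ 2 * ∑ j, ∑ k, ‖X b j k‖ ^ 2 :=
        Finset.sum_le_sum fun c _ => Finset.sum_le_sum fun bc _ => hper c bc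
    _ = 36 * ρ * ∑ bc : PBond (F.P n) 0, ∑ b : PBond (F.P K) 0, (∑ c ∈ s, (φ c bc b) ^ 2) * ∑ j, ∑ k, ‖X b j k‖ ^ 2 := by
        rw [Finset.sum_comm, Finset.mul_sum]
        refine Finset.sum_congr rfl fun bc _ => ?_
        rw [← Finset.mul_sum]
        congr 1
        rw [Finset.sum_comm]
        refine Finset.sum_congr rfl fun b _ => ?_
        rw [Finset.sum_mul]
    _ ≤ 36 * ρ * ∑ bc : PBond (F.P n) 0, ∑ b : PBond (F.P K) 0, (if (iterBlockOf (K - n) b.src = (bondShift (sites_eq F n K h) bc).src ∨ iterBlockOf (K - n) b.src = (bondShift (sites_eq F n K h) bc).tgt) then E * ∑ j, ∑ k, ‖X b j k‖ ^ 2 else 0) := by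
        refine mul_le_mul_of_nonneg_left (Finset.sum_le_sum fun bc _ => Finset.sum_le_sum fun b _ => ?_) (by positivity)
        have h1 := mul_le_mul_of_nonneg_right (hφs bc b) (hN b)
        by_cases hb : (iterBlockOf (K - n) b.src = (bondShift (sites_eq F n K h) bc).src ∨ iterBlockOf (K - n) b.src = (bondShift (sites_eq F n K h) bc).tgt)
        · simp only [if_pos hb] at h1 ⊢; exact h1
        · simp only [if_neg hb, zero_mul] at h1 ⊢; exact h1
    _ = 36 * ρ * ∑ c' : PBond (F.P K) (K - n), ∑ b : PBond (F.P K) 0, (if (iterBlockOf (K - n) b.src = (c').src ∨ iterBlockOf (K - n) b.src = (c').tgt) then E * ∑ j, ∑ k, ‖X b j k‖ ^ 2 else 0) := by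
        congr 1
        exact Fintype.sum_equiv (bondShift (sites_eq F n K h)) _
          (fun c' : PBond (F.P K) (K - n) => ∑ b : PBond (F.P K) 0, (if (iterBlockOf (K - n) b.src = (c').src ∨ iterBlockOf (K - n) b.src = (c').tgt) then E * ∑ j, ∑ k, ‖X b j k‖ ^ 2 else 0)) (fun _ => rfl)
    _ ≤ 36 * ρ * (2 * ((F.P K).d : ℝ) * ∑ b : PBond (F.P K) 0, E * ∑ j, ∑ k, ‖X b j k‖ ^ 2) :=
        mul_le_mul_of_nonneg_left (sum_sum_read_le F n K (fun b => E * ∑ j, ∑ k, ‖X b j k‖ ^ 2) fun b => by positivity) (by positivity)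
    _ = 36 * (2 * ((F.P K).d : ℝ)) * E * ρ * ∑ b : PBond (F.P K) 0, ∑ j, ∑ k, ‖X b j k‖ ^ 2 := by rw [← Finset.mul_sum]; ring
    _ ≤ 4320 * (((F.L : ℝ) ^ (K - n)) ^ 2 * B) * ρ * ∑ b : PBond (F.P K) 0, ∑ j, ∑ k, ‖X b j k‖ ^ 2 := by
        have hS : 0 ≤ ρ * ∑ b : PBond (F.P K) 0, ∑ j, ∑ k, ‖X b j k‖ ^ 2 := by positivity
        -- `36·2d·E = 216·2·((3(ℓ−1))² + ℓ²)·B ≤ 432·10ℓ²·B` at `d = 3`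
        have hEle : 36 * (2 * ((F.P K).d : ℝ)) * E ≤ 4320 * (((F.L : ℝ) ^ (K - n)) ^ 2 * B) := by
          rw [hE, show (((F.P K).d : ℝ)) = 3 by exact_mod_cast hd]
          nlinarith [hB, hℓ1, mul_nonneg (mul_nonneg (by norm_num : (0:ℝ) ≤ 6) (by nlinarith [hℓ1] : (0:ℝ) ≤ ((F.L : ℝ) ^ (K - n)) * 1)) hB,
            mul_nonneg hB (sq_nonneg (((F.L : ℝ) ^ (K - n)) - 1))]
        nlinarith [hEle, hS]

end Carrier

/-! ## §3 ★★★ The slot `hK₃`: the `Q_k`∕`L²` reading against px17's operator readings -/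

section Knit

variable (h : n ≤ K) (c₀ cB : ℝ) [Fact (0 < c₀)] [Fact (0 < cB)]

set_option maxHeartbeats 400000 in
/-- ★★★ **THE SLOT `hK₃` OF THE (L6) KNIT — THE CUTOFF COMMUTATOR OF PRINT'S `Q_k(U₀)` IN THE WEIGHTED `L²` SPACES.**  `RegPr F n K ε₀ U₀`, `10¹⁰L⁶ε₀ ≤ 1`, `10¹²L³ε₀ ≤ 1`; a family of
cut-offs `χ : ι → sites → ℝ` with `Σ_{c∈s} (χ_c(x+e_μ) − χ_c(x))² ≤ B` (px17's ✓`exists_LOD_cutoffs_corner`: `s = Zc`, `B = 2880∕(L^sℓ)²`); ANY linear operators `M_c` on the fine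
`L²` space and `N_c` on the block `L²` space with the READINGS `toL2⁻¹(M_c f)(b) = χ_c(b₋)•toL2⁻¹f(b)` and `toL2B⁻¹(N_c z)(c') = χ_c(x₀(ĉ))•toL2B⁻¹z(c')` (`x₀(ĉ)` = corner of the
source block of `ĉ = bondShift (sites_eq F n K h) c'`).  Then for every `A`:
`Σ_{c∈s} ‖Qk U₀ (M_c A) − N_c (Qk U₀ A)‖² ≤ 4320·(ℓ²B)·(cB∕(c₀ℓ^d))·‖A‖²` — w5's `hK₃` with `μ₃ = 0` and `κ₃² = a·4320·ℓ²B·cB∕(c₀ℓ^d)` (= `4320·2880·a∕L^{2s}` at the pins).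
[cite: Balaban1985BackgroundPropagators, (3.13)-(3.16) p.393, (3.100) pp.413-414; Balaban1985Variational, (44)-(45) p.285, (72) p.289; Balaban1984PropagatorsI, (1.18) p.20] -/
theorem sum_normSq_Qk_cutoff_comm_le {ε₀ : ℝ} (hε₀ : 0 < ε₀) (hε : 10 ^ 10 * (F.L : ℝ) ^ 6 * ε₀ ≤ 1) (hε12 : 10 ^ 12 * (F.L : ℝ) ^ 3 * ε₀ ≤ 1)
    (W : GaugeField (F.P K) 0 (Matrix.specialUnitaryGroup (Fin 2) ℂ)) (hreg : RegPr F n K ε₀ W)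
    {ι : Type*} (s : Finset ι) (χ : ι → Site (F.P K) 0 → ℝ) {B : ℝ} (hB : 0 ≤ B)
    (hfam : ∀ (x : Site (F.P K) 0) (μ : Fin (F.P K).d), ∑ c ∈ s, (χ c (x.shift μ) - χ c x) ^ 2 ≤ B)
    (M : ι → (BondL2K ℂ 3 (periodsT3 F K) c₀ W₂ →ₗ[ℂ] BondL2K ℂ 3 (periodsT3 F K) c₀ W₂))
    (N : ι → (WL2 ℂ (fun _ : PBond (F.P n) 0 => cB) W₂ →ₗ[ℂ] WL2 ℂ (fun _ : PBond (F.P n) 0 => cB) W₂))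
    (hM : ∀ c f b, (toL2 F K c₀).symm (M c f) b = χ c b.src • (toL2 F K c₀).symm f b)
    (hN : ∀ c z bc, (toL2B F n cB).symm (N c z) bc = χ c (Site.fibreSite 0 (K - n) (bondShift (sites_eq F n K h) bc).src fun _ => (⟨0, pow_pos (F.P K).L_pos (K - n)⟩ : Fin ((F.P K).L ^ (K - n)))) • (toL2B F n cB).symm z bc)
    (A : BondL2K ℂ 3 (periodsT3 F K) c₀ W₂) :
    ∑ c ∈ s, ‖Qk F n K h c₀ cB W (M c A) - N c (Qk F n K h c₀ cB W A)‖ ^ 2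
      ≤ 4320 * (((F.L : ℝ) ^ (K - n)) ^ 2 * B) * (cB / (c₀ * ((F.L : ℝ) ^ (K - n)) ^ (F.P K).d)) * ‖A‖ ^ 2 := by
  classical
  have hc₀ : (0 : ℝ) < c₀ := Fact.out
  have hcB : (0 : ℝ) < cB := Fact.out
  have hL0 : (0 : ℝ) < F.L := by
    have h3 : 3 ≤ F.L := by obtain ⟨a, ha⟩ := F.hL.1; have := F.hL.2; omega
    have : (3 : ℝ) ≤ F.L := by exact_mod_cast h3
    linarith
  have hℓd0 : (0 : ℝ) < ((F.L : ℝ) ^ (K - n)) ^ (F.P K).d := by positivity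
  have hηℓ : eta F n K * (F.L : ℝ) ^ (K - n) = 1 := by
    rw [eta, inv_pow]; exact inv_mul_cancel₀ (pow_ne_zero _ hL0.ne')
  have hηℓ2 : (eta F n K) ^ 2 * ((F.L : ℝ) ^ (K - n)) ^ 2 = 1 := by rw [← mul_pow, hηℓ, one_pow]
  -- read `A` on the carriers
  set X : PBond (F.P K) 0 → Matrix (Fin 2) (Fin 2) ℂ := (toL2 F K c₀).symm A with hX
  have hA : A = toL2 F K c₀ X := by rw [hX, LinearEquiv.apply_symm_apply]
  -- the readings as carrier identities
  have hMc : ∀ c, M c A = toL2 F K c₀ (fun b => χ c b.src • X b) := by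
    intro c
    rw [← LinearEquiv.symm_apply_eq]  -- hmm: want (toL2).symm (M c A) = fun b => … 
    funext b
    exact hM c A b
  have hNc : ∀ (c : ι) (Z : PBond (F.P n) 0 → Matrix (Fin 2) (Fin 2) ℂ), N c (toL2B F n cB Z) = toL2B F n cB (fun bc => χ c (Site.fibreSite 0 (K - n) (bondShift (sites_eq F n K h) bc).src fun _ => (⟨0, pow_pos (F.P K).L_pos (K - n)⟩ : Fin ((F.P K).L ^ (K - n)))) • Z bc) := by
    intro c Z
    rw [← LinearEquiv.symm_apply_eq]
    funext bc
    rw [hN c (toL2B F n cB Z) bc, LinearEquiv.symm_apply_apply]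
  -- the difference on the carriers
  have hdiff : ∀ c, Qk F n K h c₀ cB W (M c A) - N c (Qk F n K h c₀ cB W A)
      = ((eta F n K : ℝ) : ℂ) • toL2B F n cB (fun bc => QTwS F n K h W (fun b => χ c b.src • X b) bc - χ c (Site.fibreSite 0 (K - n) (bondShift (sites_eq F n K h) bc).src fun _ => (⟨0, pow_pos (F.P K).L_pos (K - n)⟩ : Fin ((F.P K).L ^ (K - n)))) • QTwS F n K h W X bc) := by
    intro c
    rw [hMc c, Qk_toL2, hA, Qk_toL2, map_smul, hNc, ← smul_sub, ← map_sub]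
    rfl
  have hcar := sum_normSq_entries_QTwS_cutoff_comm_le F n K h hε₀ hε hε12 W hreg s χ hB hfam X
  have hT : ‖A‖ ^ 2 = c₀ * ∑ b : PBond (F.P K) 0, ∑ j, ∑ k, ‖X b j k‖ ^ 2 := by rw [hA, norm_sq_toL2]
  set T : ℝ := ∑ b : PBond (F.P K) 0, ∑ j, ∑ k, ‖X b j k‖ ^ 2 with hTdef
  have hT0 : 0 ≤ T := by positivity
  calc ∑ c ∈ s, ‖Qk F n K h c₀ cB W (M c A) - N c (Qk F n K h c₀ cB W A)‖ ^ 2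
      = ∑ c ∈ s, (eta F n K) ^ 2 * (cB * ∑ bc : PBond (F.P n) 0, ∑ j, ∑ k,
          ‖(QTwS F n K h W (fun b => χ c b.src • X b) bc - χ c (Site.fibreSite 0 (K - n) (bondShift (sites_eq F n K h) bc).src fun _ => (⟨0, pow_pos (F.P K).L_pos (K - n)⟩ : Fin ((F.P K).L ^ (K - n)))) • QTwS F n K h W X bc) j k‖ ^ 2) := by
        refine Finset.sum_congr rfl fun c _ => ?_
        rw [hdiff c, normSq_eta_smul_toL2B]
    _ = (eta F n K) ^ 2 * cB * ∑ c ∈ s, ∑ bc : PBond (F.P n) 0, ∑ j, ∑ k,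
          ‖(QTwS F n K h W (fun b => χ c b.src • X b) bc - χ c (Site.fibreSite 0 (K - n) (bondShift (sites_eq F n K h) bc).src fun _ => (⟨0, pow_pos (F.P K).L_pos (K - n)⟩ : Fin ((F.P K).L ^ (K - n)))) • QTwS F n K h W X bc) j k‖ ^ 2 := by
        rw [Finset.mul_sum]; refine Finset.sum_congr rfl fun c _ => ?_; ring
    _ ≤ (eta F n K) ^ 2 * cB * (4320 * (((F.L : ℝ) ^ (K - n)) ^ 2 * B) * (((F.L : ℝ) ^ (K - n)) ^ 2 / ((F.L : ℝ) ^ (K - n)) ^ (F.P K).d) * T) := by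
        rw [hTdef]; gcongr
    _ = ((eta F n K) ^ 2 * ((F.L : ℝ) ^ (K - n)) ^ 2) * (4320 * (((F.L : ℝ) ^ (K - n)) ^ 2 * B) * cB * T / ((F.L : ℝ) ^ (K - n)) ^ (F.P K).d) := by ring
    _ = 4320 * (((F.L : ℝ) ^ (K - n)) ^ 2 * B) * cB * T / ((F.L : ℝ) ^ (K - n)) ^ (F.P K).d := by rw [hηℓ2, one_mul]
    _ = 4320 * (((F.L : ℝ) ^ (K - n)) ^ 2 * B) * (cB / (c₀ * ((F.L : ℝ) ^ (K - n)) ^ (F.P K).d)) * (c₀ * T) := by field_simp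
    _ = 4320 * (((F.L : ℝ) ^ (K - n)) ^ 2 * B) * (cB / (c₀ * ((F.L : ℝ) ^ (K - n)) ^ (F.P K).d)) * ‖A‖ ^ 2 := by rw [hT]

/-- ★★★ **`hK₃` IN THE KNIT's BINDER SHAPE** (`μ₃ = 0`): `a·Σ_{c∈s} ‖Qk U₀ (M_c A) − N_c (Qk U₀ A)‖² ≤ (a·4320·ℓ²B·cB∕(c₀ℓ^d))·‖A‖² + 0·q` for any `a ≥ 0` and any real `q`
(the knit's `q_U A`). [cite: Balaban1985BackgroundPropagators, (3.13)-(3.16) p.393; Balaban1984PropagatorsI, (1.18) p.20] -/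
theorem hK3_of_readings {ε₀ : ℝ} (hε₀ : 0 < ε₀) (hε : 10 ^ 10 * (F.L : ℝ) ^ 6 * ε₀ ≤ 1) (hε12 : 10 ^ 12 * (F.L : ℝ) ^ 3 * ε₀ ≤ 1)
    (W : GaugeField (F.P K) 0 (Matrix.specialUnitaryGroup (Fin 2) ℂ)) (hreg : RegPr F n K ε₀ W)
    {ι : Type*} (s : Finset ι) (χ : ι → Site (F.P K) 0 → ℝ) {B : ℝ} (hB : 0 ≤ B)
    (hfam : ∀ (x : Site (F.P K) 0) (μ : Fin (F.P K).d), ∑ c ∈ s, (χ c (x.shift μ) - χ c x) ^ 2 ≤ B)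
    (M : ι → (BondL2K ℂ 3 (periodsT3 F K) c₀ W₂ →ₗ[ℂ] BondL2K ℂ 3 (periodsT3 F K) c₀ W₂))
    (N : ι → (WL2 ℂ (fun _ : PBond (F.P n) 0 => cB) W₂ →ₗ[ℂ] WL2 ℂ (fun _ : PBond (F.P n) 0 => cB) W₂))
    (hM : ∀ c f b, (toL2 F K c₀).symm (M c f) b = χ c b.src • (toL2 F K c₀).symm f b)
    (hN : ∀ c z bc, (toL2B F n cB).symm (N c z) bc = χ c (Site.fibreSite 0 (K - n) (bondShift (sites_eq F n K h) bc).src fun _ => (⟨0, pow_pos (F.P K).L_pos (K - n)⟩ : Fin ((F.P K).L ^ (K - n)))) • (toL2B F n cB).symm z bc)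
    {a : ℝ} (ha : 0 ≤ a) (q : ℝ) (A : BondL2K ℂ 3 (periodsT3 F K) c₀ W₂) :
    a * ∑ c ∈ s, ‖Qk F n K h c₀ cB W (M c A) - N c (Qk F n K h c₀ cB W A)‖ ^ 2
      ≤ (a * (4320 * (((F.L : ℝ) ^ (K - n)) ^ 2 * B) * (cB / (c₀ * ((F.L : ℝ) ^ (K - n)) ^ (F.P K).d)))) * ‖A‖ ^ 2 + 0 * q := by
  have h1 := sum_normSq_Qk_cutoff_comm_le F n K h c₀ cB hε₀ hε hε12 W hreg s χ hB hfam M N hM hN A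
  have h2 := mul_le_mul_of_nonneg_left h1 ha
  rw [zero_mul, add_zero, mul_assoc]
  exact h2

end Knit

end Summit.QuantumFields.YangMills.Theorems.Prop7QkCutoffCommutator

end
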